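import Mathlib.LinearAlgebra.Matrix.GeneralLinearGroup.Card
import Mathlib.LinearAlgebra.FiniteDimensional.Lemmas
import Mathlib.LinearAlgebra.Dual.Lemmas
import Literature.Computability.AlgebraicComplexity.MatMulTwoThreeNRankBounds
import HarnessLib

/-!
# Alekseev–Nazarov 2019: the bilinear complexity of `2 × 2` by `2 × m` matrix multiplication over a finite field

Topic `Literature/Computability/AlgebraicComplexity` (bilinear complexity of small formats over finite
fields). PROVED theorems, no named facts: the printed proof (Lemmas 1–7) of

* **Alekseev–Nazarov 2019, Theorem.** For every finite field `F` with `K` elements and every `m`,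
  `R_F(⟨2,2,m⟩) ≥ (3 + 3/(K² + 2)) m`, i.e. `(K² + 2) R ≥ 3 (K² + 3) m`
  (`alekseevNazarov2019_rank_matMulTensor_22m_ge`, rational form `…_ge'`); this is the case `s = n = 2`
  (`f = K² + 3`) of the named fact `nazarov2023_rank_matMulTensor_ge` (`Nazarov2023FiniteFieldRankBound.lean`),
  whose general case is proved in the source by the same orbit-counting scheme.
* **Corollary over `𝔽₂`** (`K = 2`: `2R ≥ 7m`) with the tree's Hopcroft–Kerr upper bound
  `R(⟨2,2,n⟩) ≤ ⌈7n/2⌉` (`hopcroftKerr1971_tensorRank_matMulTensor_22n_le`): `R_𝔽₂(⟨2,2,n⟩) = ⌈7n/2⌉` for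
  every `n` and every field with two elements (`tensorRank_matMulTensor_22n_card_two`; Hopcroft–Kerr 1971
  over `𝔽₂`), in particular `R_𝔽₂(⟨2,2,5⟩) = 18`; over a field with three elements `11 R ≥ 36 m`.

The summit-side census files `Summits/MatrixMultiplication/OmegaCensus/SmallFormats/MatMul22nRankFiniteField.lean`
(cap counting over dual-number planes, a different argument) and `…/MatMul22nRankGF2LowerBound.lean` prove the
same two inequalities; this file is the `Literature/` vendoring of the printed argument (importable from
`Literature/`, and the lemma kit — `GL₂ × GL₂` orbit counting, Lemmas 5–7 for `BilinComp` — is the one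
Nazarov 2023 extends to `s ≥ n ≥ 2`).

## The printed proof and this file

A bilinear computation of `⟨2,2,m⟩` with `d` terms is `xy = ∑_t f_t(x) g_t(y) w_t`
(`BilinComp (mulBilin F 2 2 m) ι`); `A_t ∈ F^{2×2}` is the coefficient matrix of `f_t` (`AlekseevNazarov2019.A`).

* Lemma 6 (type-1 subspace `L₁ = ⟨E₁₁, E₁₂ − E₂₁⟩`): if `k` of the `A_t` lie in `L₁` then `d ≥ 3m + k`
  (`three_mul_add_card_Z1_le`): substitute `x₁₁ = 0`, `x₁₂ = x₂₁`; the printed basis exchange is done as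
  rank–nullity for the restriction-to-the-first-row map plus a column count.
* Lemma 7 (type-2 subspace `L₂ = ⟨E₁₁, E₁₂⟩`): if `k` of the `A_t` lie in `L₂` then `2d ≥ 6m + k`
  (`six_mul_add_card_Z2_le`): a maximal independent subfamily of the second-row parts `D'_t`, the modified
  forms `D̃_i`, and the column count `2m ≤ k + 2(d − k − t)`.
* Lemma 5: `P A_t Q` are the coefficient matrices of an equivalent computation (`twist`, via `BilinComp.comap`).
* Lemmas 1–4: `GL₂(F) × GL₂(F)` acts on `F^{2×2}` (`act`) with orbits `{0}`, rank one (`IsRk1`, base point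
  `E₁₁`, Lemma 3 = `exists_act_single_eq`), invertible (`IsRk2`); `N(A, C) = #{(P,Q) : PAQ = C}` (`cnt`) is
  constant on orbit pairs (`cnt_eq_of_orbit`) and `R_r N_r = |G|²` (`card_mul_cnt`); `|G| = (K²−1)(K²−K)`
  (`card_GL2`, from `Matrix.card_GL_field`), `1 + R₁ + R₂ = K⁴` (`card_orbits`); `L₁` contains `K − 1`
  rank-one and `K² − K` invertible matrices, `L₂` contains `K² − 1` rank-one matrices (`card_T1_rk1`,
  `card_T1_rk2`, `card_T2_rk1`).
* Theorem: double counting `∑_{(P,Q)} #{t : P A_t Q ∈ L} = ∑_t #{(P,Q) : P A_t Q ∈ L}` and pigeonhole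
  (`exists_good`) give a pair `(P, Q)` for each type; with Lemmas 6, 7 and the printed arithmetic (`arith`, in
  the integer form `R₁ E ≥ d₀R₁ + d₁(K−1) + d₂(K+1)`, `2(K+1)E ≥ d₀(K+1) + d₁`, `E = d − 3m`) one gets
  `(K² + 3) E ≥ d`, i.e. `(K² + 2) d ≥ 3 (K² + 3) m` (`card_ge`).

## References

* V. B. Alekseev, A. A. Nazarov, *On the bilinear complexity of multiplying a `2 × 2` matrix by a
  `2 × m` matrix over a finite field*, Vestn. Mosk. Univ. Ser. 15 Vychisl. Mat. Kibern. 2019, no. 4,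
  5–10; transl. Moscow Univ. Comput. Math. Cybern. 43 (2019) 149–155, doi:10.3103/s0278641919040022.
  Theorem (p. 5 / p. 149), Lemmas 1–7. [AlekseevNazarov2019]
* J. E. Hopcroft, L. R. Kerr, *On minimizing the number of multiplications necessary for matrix
  multiplication*, SIAM J. Appl. Math. 20 (1971) 30–36 (upper bound `⌈7n/2⌉`; lower bound over `𝔽₂`).
  [HopcroftKerr1971]
* A. A. Nazarov, Vestn. Mosk. Univ. Ser. 15 (2023) no. 4, 41–53 (the general theorem). [Nazarov2023FiniteFieldLB]
-/

namespace Literature.Computability.AlgebraicComplexity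

open Module Matrix

namespace AlekseevNazarov2019

variable {F : Type*} [Field F] {m : ℕ} {ι : Type*} [Fintype ι]

/-- The dual of `F^{2×m}` (the `y`-forms). [cite: AlekseevNazarov2019, §2 (the matrices `B_i`)] -/
abbrev Yd (F : Type*) [Field F] (m : ℕ) := Module.Dual F (Matrix (Fin 2) (Fin m) F)

/-- The coordinate functional `y ↦ y_{rj}`. [cite: AlekseevNazarov2019, §3 (the variables `y_{ij}`)] -/
def yc (r : Fin 2) (j : Fin m) : Yd F m where
  toFun y := y r j
  map_add' _ _ := rfl
  map_smul' _ _ := rfl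

/-- `yc r j y = y r j`. [cite: AlekseevNazarov2019, §3] -/
@[simp] theorem yc_apply (r : Fin 2) (j : Fin m) (y : Matrix (Fin 2) (Fin m) F) :
    yc r j y = y r j := rfl

/-- Expansion of a `y`-form in the coordinate functionals. [folklore] -/
private theorem dual_eq_sum_yc (φ : Yd F m) :
    φ = ∑ r, ∑ j, φ (Matrix.single r j 1) • (yc r j : Yd F m) := by
  ext y
  conv_lhs => rw [Matrix.matrix_eq_sum_single y]
  simp only [map_sum, LinearMap.coe_sum, Finset.sum_apply, LinearMap.smul_apply, yc_apply,
    smul_eq_mul]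
  refine Finset.sum_congr rfl fun r _ => Finset.sum_congr rfl fun j _ => ?_
  rw [show Matrix.single r j (y r j) = y r j • Matrix.single r j (1 : F) by
    rw [Matrix.smul_single, smul_eq_mul, mul_one], map_smul, smul_eq_mul, mul_comm]

/-- `dim (F^{2×m})* = 2m`. [folklore] -/
private theorem finrank_Yd : finrank F (Yd F m) = 2 * m := by
  rw [Subspace.dual_finrank_eq, Module.finrank_matrix]
  simp

/-- The coordinate functionals of one row are linearly independent. [folklore] -/
private theorem linearIndependent_yc (r : Fin 2) : LinearIndependent F (fun j : Fin m => (yc r j : Yd F m)) := by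
  rw [Fintype.linearIndependent_iff]
  intro c hc j
  have h := LinearMap.congr_fun hc (Matrix.single r j (1 : F))
  simp only [LinearMap.coe_sum, Finset.sum_apply, LinearMap.smul_apply, yc_apply, smul_eq_mul,
    LinearMap.zero_apply] at h
  rw [Finset.sum_eq_single j (fun j' _ hj => by
      rw [Matrix.single_apply_of_col_ne r r (Ne.symm hj) (1 : F), mul_zero]) (by simp)] at h
  simpa using h

section Computation

variable (β : BilinComp (mulBilin F 2 2 m) ι)

/-- The coefficient matrix `A_t` of the form `f_t` (`f_t(x) = ∑ (A_t)_{il} x_{il}`).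
[cite: AlekseevNazarov2019, §2 (the matrices `A_i`)] -/
def A (t : ι) : Matrix (Fin 2) (Fin 2) F := Matrix.of fun i l => β.f t (Matrix.single i l 1)

/-- Entries of `A_t`. [cite: AlekseevNazarov2019, §2] -/
@[simp] theorem A_apply (t : ι) (i l : Fin 2) : A β t i l = β.f t (Matrix.single i l 1) := rfl

/-- `f_t(x) = ∑ x_{il} (A_t)_{il}`. [cite: AlekseevNazarov2019, §2] -/
theorem f_eq_sum (t : ι) (x : Matrix (Fin 2) (Fin 2) F) :
    β.f t x = ∑ i, ∑ l, x i l * A β t i l := by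
  conv_lhs => rw [Matrix.matrix_eq_sum_single x]
  simp only [map_sum, A_apply]
  refine Finset.sum_congr rfl fun i _ => Finset.sum_congr rfl fun l _ => ?_
  rw [show Matrix.single i l (x i l) = x i l • Matrix.single i l (1 : F) by
    rw [Matrix.smul_single, smul_eq_mul, mul_one], map_smul, smul_eq_mul]

/-- The computation at `x = E_{il}`, entry `(i, j)`: `∑_t (A_t)_{il} w_t[i,j] g_t = y_{lj}`.
[cite: AlekseevNazarov2019, §3 (the identities for the forms `D_i`)] -/
theorem sum_same (i l : Fin 2) (j : Fin m) :
    ∑ t, (A β t i l * β.w t i j) • β.g t = (yc l j : Yd F m) := by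
  ext y
  have h := β.map_eq_sum (Matrix.single i l 1) y
  rw [mulBilin_apply] at h
  have h1 := congrFun (congrFun h i) j
  rw [Matrix.single_mul_apply_same, one_mul] at h1
  simp only [LinearMap.coe_sum, Finset.sum_apply, LinearMap.smul_apply, smul_eq_mul, yc_apply,
    A_apply]
  rw [h1]
  simp only [Matrix.sum_apply, Matrix.smul_apply, smul_eq_mul]
  exact Finset.sum_congr rfl fun t _ => by ring

/-- The computation at `x = E_{il}`, entry `(r, j)` with `r ≠ i`: `∑_t (A_t)_{il} w_t[r,j] g_t = 0`.
[cite: AlekseevNazarov2019, §3 (the identities for the forms `D_i`)] -/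
theorem sum_ne (i l r : Fin 2) (j : Fin m) (hr : r ≠ i) :
    ∑ t, (A β t i l * β.w t r j) • β.g t = (0 : Yd F m) := by
  ext y
  have h := β.map_eq_sum (Matrix.single i l 1) y
  rw [mulBilin_apply] at h
  have h1 := congrFun (congrFun h r) j
  rw [Matrix.single_mul_apply_of_ne (1 : F) i l r j hr] at h1
  simp only [LinearMap.coe_sum, Finset.sum_apply, LinearMap.smul_apply, smul_eq_mul,
    LinearMap.zero_apply, A_apply]
  rw [h1]
  simp only [Matrix.sum_apply, Matrix.smul_apply, smul_eq_mul]
  exact Finset.sum_congr rfl fun t _ => by ring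

/-! ## Lemma 6: forms of type 1 (`A_t ∈ L₁ = ⟨E₁₁, E₁₂ − E₂₁⟩`) -/

/-- The indices `t` with `A_t ∈ L₁`, i.e. `(A_t)₁₂ + (A_t)₂₁ = 0` and `(A_t)₂₂ = 0`: exactly the
forms vanishing under the substitution `x₁₁ = 0`, `x₁₂ = x₂₁`. [cite: AlekseevNazarov2019, Lemma 6] -/
noncomputable def Z1 : Finset ι := by
  classical exact Finset.univ.filter fun t => A β t 0 1 + A β t 1 0 = 0 ∧ A β t 1 1 = 0

/-- Membership in `Z1`. [cite: AlekseevNazarov2019, Lemma 6] -/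
theorem mem_Z1 {t : ι} : t ∈ Z1 β ↔ A β t 0 1 + A β t 1 0 = 0 ∧ A β t 1 1 = 0 := by
  classical
  simp [Z1]

/-- The substituted form `D_t` restricted to `x = [0 s; s r]`, as the pair (coefficient of `s`,
coefficient of `r`) of `y`-forms: `((A₁₂ + A₂₁) g_t, A₂₂ g_t)`. [cite: AlekseevNazarov2019, Lemma 6 (proof)] -/
def Dp (t : ι) : Yd F m × Yd F m := ((A β t 0 1 + A β t 1 0) • β.g t, A β t 1 1 • β.g t)

/-- Forms of type 1 vanish after the substitution. [cite: AlekseevNazarov2019, Lemma 6 (proof)] -/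
theorem Dp_eq_zero {t : ι} (ht : t ∈ Z1 β) : Dp β t = 0 := by
  obtain ⟨h1, h2⟩ := (mem_Z1 β).1 ht
  unfold Dp
  rw [h1, h2, zero_smul]
  rfl

/-- The first-row outputs after substitution: `∑_t w_t[1,j] D_t = (y_{2j}, 0)` (`s y_{2j}`).
[cite: AlekseevNazarov2019, Lemma 6 (proof)] -/
theorem T1_eq (j : Fin m) : ∑ t, β.w t 0 j • Dp β t = ((yc 1 j : Yd F m), 0) := by
  have e1 := sum_same β 0 1 j
  have e2 := sum_ne β 1 0 0 j (by decide)
  have e3 := sum_ne β 1 1 0 j (by decide)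
  ext1
  · simp only [Prod.fst_sum, Prod.smul_fst, Dp, smul_smul]
    rw [← add_zero (yc 1 j : Yd F m), ← e1, ← e2, ← Finset.sum_add_distrib]
    exact Finset.sum_congr rfl fun t _ => by rw [← add_smul]; ring_nf
  · simp only [Prod.snd_sum, Prod.smul_snd, Dp, smul_smul]
    rw [← e3]
    exact Finset.sum_congr rfl fun t _ => by ring_nf

/-- The second-row outputs after substitution: `∑_t w_t[2,j] D_t = (y_{1j}, y_{2j})`
(`s y_{1j} + r y_{2j}`). [cite: AlekseevNazarov2019, Lemma 6 (proof)] -/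
theorem T2_eq (j : Fin m) : ∑ t, β.w t 1 j • Dp β t = ((yc 0 j : Yd F m), (yc 1 j : Yd F m)) := by
  have e1 := sum_ne β 0 1 1 j (by decide)
  have e2 := sum_same β 1 0 j
  have e3 := sum_same β 1 1 j
  ext1
  · simp only [Prod.fst_sum, Prod.smul_fst, Dp, smul_smul]
    rw [← zero_add (yc 0 j : Yd F m), ← e1, ← e2, ← Finset.sum_add_distrib]
    exact Finset.sum_congr rfl fun t _ => by rw [← add_smul]; ring_nf
  · simp only [Prod.snd_sum, Prod.smul_snd, Dp, smul_smul]
    rw [← e3]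
    exact Finset.sum_congr rfl fun t _ => by ring_nf

/-- Rank–nullity as an inequality: if `N ≤ V` is killed by `f` then `dim f(V) + dim N ≤ dim V`.
[folklore] -/
private theorem finrank_map_add_le {M M' : Type*} [AddCommGroup M] [Module F M] [AddCommGroup M']
    [Module F M'] [FiniteDimensional F M] (f : M →ₗ[F] M') (V N : Submodule F M) (hNV : N ≤ V)
    (hNf : N ≤ LinearMap.ker f) : finrank F (V.map f) + finrank F N ≤ finrank F V := by
  have hrn := LinearMap.finrank_range_add_finrank_ker (f.domRestrict V)
  rw [LinearMap.range_domRestrict, LinearMap.ker_domRestrict] at hrn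
  have hN : finrank F N ≤ finrank F ((LinearMap.ker f).comap V.subtype) := by
    have h2 : finrank F (N.comap V.subtype) = finrank F N := by
      have := Submodule.finrank_map_subtype_eq V (N.comap V.subtype)
      rw [Submodule.map_comap_subtype, inf_eq_right.2 hNV] at this
      exact this.symm
    rw [← h2]
    exact Submodule.finrank_mono (Submodule.comap_mono hNf)
  omega

/-- The restriction of a `y`-form to the first row: `φ ↦ (j ↦ φ(E_{1j}))`; it kills exactly the
second-row coordinate functionals. [cite: AlekseevNazarov2019, Lemma 6 (proof: "добавляя к `D_{2i}`
линейные комбинации `D_{1j}`")] -/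
def τ : Yd F m →ₗ[F] (Fin m → F) where
  toFun φ := fun j => φ (Matrix.single 0 j 1)
  map_add' _ _ := rfl
  map_smul' _ _ := rfl

/-- `τ φ j = φ(E_{1j})`. [cite: AlekseevNazarov2019, Lemma 6 (proof)] -/
@[simp] theorem τ_apply (φ : Yd F m) (j : Fin m) : τ φ j = φ (Matrix.single 0 j 1) := rfl

/-- `τ` kills the second-row coordinates. [cite: AlekseevNazarov2019, Lemma 6 (proof)] -/
theorem τ_yc_one (j : Fin m) : τ (yc 1 j : Yd F m) = 0 := by
  ext j'
  simp

/-- `τ` of a first-row coordinate is a unit vector. [cite: AlekseevNazarov2019, Lemma 6 (proof)] -/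
theorem τ_yc_zero (j : Fin m) : τ (yc 0 j : Yd F m) = Pi.single j 1 := by
  ext j'
  simp only [τ_apply, yc_apply, Matrix.single_apply, true_and, Pi.single_apply]

/-- `ρ = τ × id` on pairs of `y`-forms. [cite: AlekseevNazarov2019, Lemma 6 (proof)] -/
def ρ : (Yd F m × Yd F m) →ₗ[F] ((Fin m → F) × Yd F m) := (τ : Yd F m →ₗ[F] _).prodMap LinearMap.id

/-- `ρ (φ, ψ) = (τ φ, ψ)`. [cite: AlekseevNazarov2019, Lemma 6 (proof)] -/
@[simp] theorem ρ_apply (φ ψ : Yd F m) : ρ (φ, ψ) = (τ φ, ψ) := rfl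

/-- **Lemma 6.** If `k` of the forms `f_t` are of type 1 (`A_t ∈ L₁`) then `d ≥ 3m + k`.
[cite: AlekseevNazarov2019, Lemma 6] -/
theorem three_mul_add_card_Z1_le : 3 * m + (Z1 β).card ≤ Fintype.card ι := by
  classical
  -- the span `V` of the substituted forms and its dimension
  let V : Submodule F (Yd F m × Yd F m) := Submodule.span F (Set.range (Dp β))
  have hVle : finrank F V + (Z1 β).card ≤ Fintype.card ι := by
    have hle : V ≤ Submodule.span F (↑(((Z1 β)ᶜ).image (Dp β)) : Set (Yd F m × Yd F m)) := by
      rw [Submodule.span_le]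
      rintro _ ⟨t, rfl⟩
      by_cases ht : t ∈ Z1 β
      · rw [Dp_eq_zero β ht]; exact zero_mem _
      · refine Submodule.subset_span ?_
        rw [Finset.coe_image]
        exact ⟨t, by simpa using ht, rfl⟩
    have h1 : finrank F (Submodule.span F (↑(((Z1 β)ᶜ).image (Dp β)) : Set (Yd F m × Yd F m))) ≤
        (((Z1 β)ᶜ).image (Dp β)).card := finrank_span_finset_le_card (R := F) _
    have h2 : (((Z1 β)ᶜ).image (Dp β)).card ≤ (Z1 β)ᶜ.card := Finset.card_image_le
    rw [Finset.card_compl] at h2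
    have h3 : (Z1 β).card ≤ Fintype.card ι := Finset.card_le_univ _
    have h4 := Submodule.finrank_mono hle
    omega
  -- `N1 = ⟨(y_{2j}, 0)⟩ ≤ V`, of dimension `m`, killed by `ρ`
  let N1 : Submodule F (Yd F m × Yd F m) :=
    Submodule.span F (Set.range fun j : Fin m => ((yc 1 j : Yd F m), (0 : Yd F m)))
  have hN1V : N1 ≤ V := by
    rw [Submodule.span_le]
    rintro _ ⟨j, rfl⟩
    show ((yc 1 j : Yd F m), (0 : Yd F m)) ∈ V
    rw [← T1_eq β j]
    exact Submodule.sum_mem _ fun t _ => Submodule.smul_mem _ _ (Submodule.subset_span ⟨t, rfl⟩)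
  have hN1rank : finrank F N1 = m := by
    have hli : LinearIndependent F (fun j : Fin m => ((yc 1 j : Yd F m), (0 : Yd F m))) :=
      (linearIndependent_yc (F := F) (m := m) 1).map' (LinearMap.inl F (Yd F m) (Yd F m))
        Submodule.ker_inl
    rw [finrank_span_eq_card hli, Fintype.card_fin]
  have hN1ker : N1 ≤ LinearMap.ker (ρ : (Yd F m × Yd F m) →ₗ[F] _) := by
    rw [Submodule.span_le]
    rintro _ ⟨j, rfl⟩
    simp [τ_yc_one]
  have hmap : finrank F (V.map ρ) + m ≤ finrank F V := by
    have := finrank_map_add_le (F := F) ρ V N1 hN1V hN1ker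
    rwa [hN1rank] at this
  -- a maximal independent subfamily `S` of the `ρ D_t`
  obtain ⟨s, hli, hmax⟩ := exists_maximal_linearIndepOn F (fun t => ρ (Dp β t))
  let S : Finset ι := s.toFinset
  have hSs : (S : Set ι) = s := by simp [S]
  have hspanS : Submodule.span F ((fun t => ρ (Dp β t)) '' s) = V.map ρ := by
    rw [Submodule.map_span, ← Set.range_comp]
    apply le_antisymm
    · exact Submodule.span_mono (Set.image_subset_range _ _)
    · rw [Submodule.span_le]
      rintro _ ⟨t, rfl⟩
      by_cases hts : t ∈ s
      · exact Submodule.subset_span ⟨t, hts, rfl⟩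
      · obtain ⟨a, ha, hat⟩ := hmax t hts
        have := Submodule.smul_mem _ a⁻¹ hat
        rwa [smul_smul, inv_mul_cancel₀ ha, one_smul] at this
  have hScard : S.card = finrank F (V.map ρ) := by
    have hcard := finrank_span_eq_card hli.linearIndependent
    have hrange : Set.range (fun x : ↥s => ρ (Dp β x)) = (fun t => ρ (Dp β t)) '' s := by
      ext φ; simp
    rw [hrange, hspanS] at hcard
    rw [show S.card = Fintype.card ↥s from by simp [S, Set.toFinset_card]]
    exact hcard.symm
  -- the `y`-forms `g_t`, `t ∈ S`
  let G : Submodule F (Yd F m) := Submodule.span F (↑(S.image β.g) : Set (Yd F m))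
  have hGle : finrank F G ≤ S.card :=
    (finrank_span_finset_le_card (R := F) (S.image β.g)).trans Finset.card_image_le
  have hgG : ∀ t ∈ S, β.g t ∈ G := fun t ht =>
    Submodule.subset_span (by rw [Finset.coe_image]; exact ⟨t, by simpa using ht, rfl⟩)
  -- the second-row outputs through `ρ`
  have hT2 : ∀ j : Fin m, (yc 1 j : Yd F m) ∈ G ∧ ∃ u ∈ G, τ u = Pi.single j 1 := by
    intro j
    have hmem : ρ ((yc 0 j : Yd F m), (yc 1 j : Yd F m)) ∈
        Submodule.span F ((fun t => ρ (Dp β t)) '' (S : Set ι)) := by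
      rw [hSs, hspanS]
      refine Submodule.mem_map_of_mem ?_
      rw [← T2_eq β j]
      exact Submodule.sum_mem _ fun t _ => Submodule.smul_mem _ _ (Submodule.subset_span ⟨t, rfl⟩)
    obtain ⟨c, hc⟩ := (Submodule.mem_span_image_finset_iff_exists_fun' (R := F)).1 hmem
    rw [ρ_apply, τ_yc_zero] at hc
    have h1 := congrArg Prod.fst hc
    have h2 := congrArg Prod.snd hc
    simp only [Prod.fst_sum, Prod.snd_sum, Prod.smul_fst, Prod.smul_snd, Dp, ρ_apply,
      map_smul, smul_smul] at h1 h2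
    refine ⟨?_, ⟨∑ t ∈ S, (c t * (A β t 0 1 + A β t 1 0)) • β.g t, ?_, ?_⟩⟩
    · rw [← h2]
      exact Submodule.sum_mem _ fun t ht => Submodule.smul_mem _ _ (hgG t ht)
    · exact Submodule.sum_mem _ fun t ht => Submodule.smul_mem _ _ (hgG t ht)
    · rw [← h1, map_sum]
      exact Finset.sum_congr rfl fun t _ => by rw [map_smul]
  -- `dim G ≥ 2m`: `τ(G)` is everything and `G` contains the second-row coordinates
  have hG2 : 2 * m ≤ finrank F G := by
    let N : Submodule F (Yd F m) := Submodule.span F (Set.range fun j : Fin m => (yc 1 j : Yd F m))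
    have hNG : N ≤ G := by
      rw [Submodule.span_le]
      rintro _ ⟨j, rfl⟩
      exact (hT2 j).1
    have hNker : N ≤ LinearMap.ker (τ : Yd F m →ₗ[F] _) := by
      rw [Submodule.span_le]
      rintro _ ⟨j, rfl⟩
      simp [τ_yc_one]
    have hNrank : finrank F N = m := by
      rw [finrank_span_eq_card (linearIndependent_yc (F := F) (m := m) 1), Fintype.card_fin]
    have h1 := finrank_map_add_le (F := F) τ G N hNG hNker
    have h2 : m ≤ finrank F (G.map τ) := by
      have htop : (⊤ : Submodule F (Fin m → F)) ≤ G.map τ := by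
        rw [← (Pi.basisFun F (Fin m)).span_eq, Submodule.span_le]
        rintro _ ⟨j, rfl⟩
        obtain ⟨u, hu, hτu⟩ := (hT2 j).2
        rw [SetLike.mem_coe, Pi.basisFun_apply, ← hτu]
        exact Submodule.mem_map_of_mem hu
      have := Submodule.finrank_mono htop
      rw [finrank_top, Module.finrank_fintype_fun_eq_card, Fintype.card_fin] at this
      exact this
    omega
  omega

/-! ## Lemma 7: forms of type 2 (`A_t ∈ L₂ = ⟨E₁₁, E₁₂⟩`) -/

/-- The indices `t` with `A_t ∈ L₂`, i.e. `f_t` does not involve the second row of `x`.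
[cite: AlekseevNazarov2019, Lemma 7] -/
noncomputable def Z2 : Finset ι := by
  classical exact Finset.univ.filter fun t => A β t 1 0 = 0 ∧ A β t 1 1 = 0

/-- Membership in `Z2`. [cite: AlekseevNazarov2019, Lemma 7] -/
theorem mem_Z2 {t : ι} : t ∈ Z2 β ↔ A β t 1 0 = 0 ∧ A β t 1 1 = 0 := by
  classical
  simp [Z2]

/-- The part `D'_t` of `D_t` involving the second row of `x`, as the pair (coefficient of `x₂₁`,
coefficient of `x₂₂`) of `y`-forms. [cite: AlekseevNazarov2019, Lemma 7 (proof, the forms `D'_i`)] -/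
def Dq (t : ι) : Yd F m × Yd F m := (A β t 1 0 • β.g t, A β t 1 1 • β.g t)

/-- Forms of type 2 have `D'_t = 0`. [cite: AlekseevNazarov2019, Lemma 7 (proof)] -/
theorem Dq_eq_zero {t : ι} (ht : t ∈ Z2 β) : Dq β t = 0 := by
  obtain ⟨h1, h2⟩ := (mem_Z2 β).1 ht
  unfold Dq
  rw [h1, h2, zero_smul]
  rfl

/-- The second-row outputs: `∑_t w_t[2,j] D'_t = (y_{1j}, y_{2j})` (`x₂₁ y_{1j} + x₂₂ y_{2j}`).
[cite: AlekseevNazarov2019, Lemma 7 (proof)] -/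
theorem Dq_row1 (j : Fin m) : ∑ t, β.w t 1 j • Dq β t = ((yc 0 j : Yd F m), (yc 1 j : Yd F m)) := by
  have e1 := sum_same β 1 0 j
  have e2 := sum_same β 1 1 j
  ext1
  · simp only [Prod.fst_sum, Prod.smul_fst, Dq, smul_smul]
    rw [← e1]
    exact Finset.sum_congr rfl fun t _ => by ring_nf
  · simp only [Prod.snd_sum, Prod.smul_snd, Dq, smul_smul]
    rw [← e2]
    exact Finset.sum_congr rfl fun t _ => by ring_nf

/-- The first-row outputs do not involve the second row of `x`: `∑_t w_t[1,j] D'_t = 0`.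
[cite: AlekseevNazarov2019, Lemma 7 (proof)] -/
theorem Dq_row0 (j : Fin m) : ∑ t, β.w t 0 j • Dq β t = 0 := by
  have e1 := sum_ne β 1 0 0 j (by decide)
  have e2 := sum_ne β 1 1 0 j (by decide)
  ext1
  · simp only [Prod.fst_sum, Prod.smul_fst, Dq, smul_smul, Prod.fst_zero]
    rw [← e1]
    exact Finset.sum_congr rfl fun t _ => by ring_nf
  · simp only [Prod.snd_sum, Prod.smul_snd, Dq, smul_smul, Prod.snd_zero]
    rw [← e2]
    exact Finset.sum_congr rfl fun t _ => by ring_nf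

/-- **Lemma 7.** If `k` of the forms `f_t` are of type 2 (`A_t ∈ L₂`) then `d ≥ 3m + k/2`.
[cite: AlekseevNazarov2019, Lemma 7] -/
theorem six_mul_add_card_Z2_le : 6 * m + (Z2 β).card ≤ 2 * Fintype.card ι := by
  classical
  -- a maximal independent subfamily `T` of the `D'_t` and coefficients `α`
  obtain ⟨s, hli, hmax⟩ := exists_maximal_linearIndepOn F (Dq β)
  let T : Finset ι := s.toFinset
  have hTs : (T : Set ι) = s := by simp [T]
  have hmem : ∀ i, i ∉ T → Dq β i ∈ Submodule.span F (Dq β '' (T : Set ι)) := by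
    intro i hi
    have his : i ∉ s := by simpa [T] using hi
    obtain ⟨a, ha, hai⟩ := hmax i his
    rw [hTs]
    have := Submodule.smul_mem _ a⁻¹ hai
    rwa [smul_smul, inv_mul_cancel₀ ha, one_smul] at this
  choose! α hα using fun i (hi : i ∉ T) =>
    (Submodule.mem_span_image_finset_iff_exists_fun' (R := F)).1 (hmem i hi)
  have hindep : ∀ c : ι → F, ∑ t ∈ T, c t • Dq β t = 0 → ∀ t ∈ T, c t = 0 := fun c hc t ht =>
    (linearIndepOn_iff'.1 hli) T c (by rw [hTs]) hc t ht
  -- `T` avoids the type-2 indices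
  have hTZ : Disjoint T (Z2 β) := by
    rw [Finset.disjoint_left]
    intro t ht htZ
    have h0 := Dq_eq_zero β htZ
    have := hindep (fun p => if p = t then 1 else 0) (by simp [Finset.sum_ite_eq', ht, h0]) t ht
    simp at this
  -- `|T| ≥ 2m`
  have hT2m : 2 * m ≤ T.card := by
    let G : Submodule F (Yd F m) := Submodule.span F (↑(T.image β.g) : Set (Yd F m))
    have hgG : ∀ t ∈ T, β.g t ∈ G := fun t ht =>
      Submodule.subset_span (by rw [Finset.coe_image]; exact ⟨t, by simpa using ht, rfl⟩)
    have hspan : ∀ i, Dq β i ∈ Submodule.span F (Dq β '' (T : Set ι)) := by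
      intro i
      by_cases hi : i ∈ T
      · exact Submodule.subset_span ⟨i, Finset.mem_coe.2 hi, rfl⟩
      · exact hmem i hi
    have hyc : ∀ (c : Fin 2) (j : Fin m), (yc c j : Yd F m) ∈ G := by
      intro c j
      have hmemT : ((yc 0 j : Yd F m), (yc 1 j : Yd F m)) ∈ Submodule.span F (Dq β '' (T : Set ι)) := by
        rw [← Dq_row1 β j]
        exact Submodule.sum_mem _ fun t _ => Submodule.smul_mem _ _ (hspan t)
      obtain ⟨c', hc'⟩ := (Submodule.mem_span_image_finset_iff_exists_fun' (R := F)).1 hmemT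
      have h1 := congrArg Prod.fst hc'
      have h2 := congrArg Prod.snd hc'
      simp only [Prod.fst_sum, Prod.snd_sum, Prod.smul_fst, Prod.smul_snd, Dq, smul_smul] at h1 h2
      have hc2 : c = 0 ∨ c = 1 := by fin_cases c <;> simp
      rcases hc2 with rfl | rfl
      · rw [← h1]
        exact Submodule.sum_mem _ fun t ht => Submodule.smul_mem _ _ (hgG t ht)
      · rw [← h2]
        exact Submodule.sum_mem _ fun t ht => Submodule.smul_mem _ _ (hgG t ht)
    have htop : (⊤ : Submodule F (Yd F m)) ≤ G := by
      intro φ _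
      rw [dual_eq_sum_yc φ]
      exact Submodule.sum_mem _ fun r _ => Submodule.sum_mem _ fun j _ =>
        Submodule.smul_mem _ _ (hyc r j)
    have h1 := Submodule.finrank_mono htop
    rw [finrank_top, finrank_Yd] at h1
    have h2 : finrank F G ≤ (T.image β.g).card := finrank_span_finset_le_card (R := F) (T.image β.g)
    exact h1.trans (h2.trans Finset.card_image_le)
  -- the modified forms `D̃_i = D_i − ∑ α_{it} D_t` (first-row parts), `i ∉ T`
  let u : ι → Fin 2 → Yd F m := fun i c =>
    A β i 0 c • β.g i - ∑ t ∈ T, (α i t * A β t 0 c) • β.g t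
  have hα0 : ∀ i ∈ Z2 β, ∀ t ∈ T, α i t = 0 := by
    intro i hi t ht
    have hiT : i ∉ T := fun h => Finset.disjoint_left.1 hTZ h hi
    exact hindep (α i) (by rw [hα i hiT, Dq_eq_zero β hi]) t ht
  have hu_Z2 : ∀ i ∈ Z2 β, ∀ c, u i c = A β i 0 c • β.g i := by
    intro i hi c
    simp only [u]
    rw [Finset.sum_eq_zero (fun t ht => by rw [hα0 i hi t ht, zero_mul, zero_smul]), sub_zero]
  -- the first-row outputs are combinations of the `D_t`, `t ∈ Z2`, and the `D̃_i`
  have hyc_u : ∀ (c : Fin 2) (j : Fin m), (yc c j : Yd F m) = ∑ i ∈ Tᶜ, β.w i 0 j • u i c := by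
    intro c j
    have hγ : ∀ t ∈ T, β.w t 0 j + ∑ i ∈ Tᶜ, β.w i 0 j * α i t = 0 := by
      apply hindep (fun t => β.w t 0 j + ∑ i ∈ Tᶜ, β.w i 0 j * α i t)
      have h0 := Dq_row0 β j
      rw [← Finset.sum_add_sum_compl T] at h0
      have h1 : ∑ i ∈ Tᶜ, β.w i 0 j • Dq β i =
          ∑ t ∈ T, (∑ i ∈ Tᶜ, β.w i 0 j * α i t) • Dq β t := by
        rw [Finset.sum_congr rfl (fun i hi => by
          rw [← hα i (Finset.mem_compl.1 hi), Finset.smul_sum])]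
        rw [Finset.sum_comm]
        refine Finset.sum_congr rfl fun t _ => ?_
        rw [Finset.sum_smul]
        exact Finset.sum_congr rfl fun i _ => by rw [smul_smul]
      rw [h1, ← Finset.sum_add_distrib] at h0
      rw [← h0]
      exact Finset.sum_congr rfl fun t _ => by rw [add_smul]
    have e := sum_same β 0 c j
    rw [← e, ← Finset.sum_add_sum_compl T]
    have h2 : ∑ i ∈ Tᶜ, β.w i 0 j • u i c = ∑ i ∈ Tᶜ, (A β i 0 c * β.w i 0 j) • β.g i -
        ∑ t ∈ T, ((∑ i ∈ Tᶜ, β.w i 0 j * α i t) * A β t 0 c) • β.g t := by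
      simp only [u, smul_sub, Finset.sum_sub_distrib, smul_smul, Finset.smul_sum]
      congr 1
      · exact Finset.sum_congr rfl fun i _ => by rw [mul_comm]
      · rw [Finset.sum_comm]
        refine Finset.sum_congr rfl fun t _ => ?_
        rw [Finset.sum_mul, Finset.sum_smul]
        exact Finset.sum_congr rfl fun i _ => by ring_nf
    rw [h2, eq_sub_iff_add_eq, add_assoc, add_comm (∑ i ∈ Tᶜ, (A β i 0 c * β.w i 0 j) • β.g i),
      ← add_assoc, ← Finset.sum_add_distrib]
    conv_rhs => rw [← zero_add (∑ i ∈ Tᶜ, (A β i 0 c * β.w i 0 j) • β.g i)]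
    congr 1
    refine Finset.sum_eq_zero fun t ht => ?_
    rw [← add_smul, show A β t 0 c * β.w t 0 j + (∑ i ∈ Tᶜ, β.w i 0 j * α i t) * A β t 0 c =
      (β.w t 0 j + ∑ i ∈ Tᶜ, β.w i 0 j * α i t) * A β t 0 c by ring, hγ t ht, zero_mul, zero_smul]
  -- the column count
  let R : Finset ι := (T ∪ Z2 β)ᶜ
  let CS : Finset (Yd F m) :=
    (Z2 β).image β.g ∪ (R ×ˢ (Finset.univ : Finset (Fin 2))).image (fun ic => u ic.1 ic.2)
  have hu_mem : ∀ i ∈ Tᶜ, ∀ c, u i c ∈ Submodule.span F (↑CS : Set (Yd F m)) := by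
    intro i hi c
    by_cases hiZ : i ∈ Z2 β
    · rw [hu_Z2 i hiZ c]
      refine Submodule.smul_mem _ _ (Submodule.subset_span ?_)
      simp only [CS, Finset.coe_union, Finset.coe_image, Set.mem_union, Set.mem_image,
        Finset.mem_coe]
      exact Or.inl ⟨i, hiZ, rfl⟩
    · refine Submodule.subset_span ?_
      simp only [CS, Finset.coe_union, Finset.coe_image, Set.mem_union, Set.mem_image,
        Finset.mem_coe, Finset.mem_product, Finset.mem_univ, and_true]
      refine Or.inr ⟨(i, c), ?_, rfl⟩
      simp only [R, Finset.mem_compl, Finset.mem_union, not_or]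
      exact ⟨Finset.mem_compl.1 hi, hiZ⟩
  have htop : (⊤ : Submodule F (Yd F m)) ≤ Submodule.span F (↑CS : Set (Yd F m)) := by
    intro φ _
    rw [dual_eq_sum_yc φ]
    refine Submodule.sum_mem _ fun c _ => Submodule.sum_mem _ fun j _ => Submodule.smul_mem _ _ ?_
    rw [hyc_u c j]
    exact Submodule.sum_mem _ fun i hi => Submodule.smul_mem _ _ (hu_mem i hi c)
  have h1 := Submodule.finrank_mono htop
  rw [finrank_top, finrank_Yd] at h1
  have h2 : finrank F (Submodule.span F (↑CS : Set (Yd F m))) ≤ CS.card :=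
    finrank_span_finset_le_card (R := F) CS
  have h3 : CS.card ≤ (Z2 β).card + 2 * R.card := by
    refine (Finset.card_union_le _ _).trans (Nat.add_le_add Finset.card_image_le ?_)
    refine Finset.card_image_le.trans ?_
    rw [Finset.card_product, Finset.card_univ, Fintype.card_fin, mul_comm]
  have hR : R.card + T.card + (Z2 β).card = Fintype.card ι := by
    have hc : R.card = Fintype.card ι - (T ∪ Z2 β).card := Finset.card_compl _
    rw [Finset.card_union_of_disjoint hTZ] at hc
    have : (T ∪ Z2 β).card ≤ Fintype.card ι := Finset.card_le_univ _
    rw [Finset.card_union_of_disjoint hTZ] at this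
    omega
  omega

/-! ## Lemma 5: the coefficient matrices may be replaced by `P A_t Q` -/

/-- **Lemma 5**: the computation with `f'_t(x) = f_t(Pᵀ x Qᵀ)`, `g'_t(y) = g_t((Qᵀ)⁻¹ y)`,
`w'_t = (Pᵀ)⁻¹ w_t`; its coefficient matrices are `P A_t Q` (`A_twist`).
[cite: AlekseevNazarov2019, Lemma 5] -/
noncomputable def twist (P Q : Matrix (Fin 2) (Fin 2) F) (hP : IsUnit P.det) (hQ : IsUnit Q.det) :
    BilinComp (mulBilin F 2 2 m) ι :=
  β.comap ((mulLeftLin F P.transpose).comp (mulRightLin F Q.transpose)) (mulLeftLin F (Q.transpose)⁻¹)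
    (mulLeftLin F (P.transpose)⁻¹)
    (fun x y => by
      have hP' : IsUnit (Matrix.transpose P).det := Matrix.isUnit_det_transpose P hP
      have hQ' : IsUnit (Matrix.transpose Q).det := Matrix.isUnit_det_transpose Q hQ
      simp only [LinearMap.comp_apply, mulLeftLin_apply, mulRightLin_apply, mulBilin_apply]
      rw [Matrix.mul_assoc P.transpose (x * Q.transpose), Matrix.mul_assoc x Q.transpose,
        ← Matrix.mul_assoc Q.transpose, Matrix.mul_nonsing_inv _ hQ', Matrix.one_mul,
        ← Matrix.mul_assoc (P.transpose)⁻¹, Matrix.nonsing_inv_mul _ hP', Matrix.one_mul])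

/-- The coefficient matrices of the twisted computation are `P A_t Q`. [cite: AlekseevNazarov2019, Lemma 5] -/
theorem A_twist (P Q : Matrix (Fin 2) (Fin 2) F) (hP : IsUnit P.det) (hQ : IsUnit Q.det) (t : ι) :
    A (twist β P Q hP hQ) t = P * A β t * Q := by
  ext i l
  rw [A_apply, twist, BilinComp.comap_f, LinearMap.comp_apply, mulRightLin_apply, mulLeftLin_apply,
    f_eq_sum]
  have hM : ∀ p q, (P.transpose * (Matrix.single i l (1 : F) * Q.transpose)) p q = P i p * Q q l := by
    intro p q
    rw [Matrix.mul_apply, Finset.sum_eq_single i (fun i' _ hi' => by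
        rw [Matrix.single_mul_apply_of_ne (1 : F) i l i' q hi', mul_zero]) (by simp),
      Matrix.single_mul_apply_same, one_mul, Matrix.transpose_apply, Matrix.transpose_apply]
  simp only [hM, Matrix.mul_apply, Finset.sum_mul]
  rw [Finset.sum_comm]
  exact Finset.sum_congr rfl fun q _ => Finset.sum_congr rfl fun p _ => by ring

end Computation

/-! ## Lemmas 1–4: counting over the pairs `(P, Q) ∈ GL₂(F) × GL₂(F)` -/

section Action

variable (F)

/-- The pairs `(P, Q)` of invertible `2 × 2` matrices (the source's group is `G = GL₂(F)`; pairs act by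
`A ↦ P A Q`). [cite: AlekseevNazarov2019, §3 (Lemma 1)] -/
abbrev Γ2 := GL (Fin 2) F × GL (Fin 2) F

variable {F}

/-- The action `(P, Q) · A = P A Q`. [cite: AlekseevNazarov2019, Lemma 1] -/
def act (g : Γ2 F) (A : Matrix (Fin 2) (Fin 2) F) : Matrix (Fin 2) (Fin 2) F :=
  (g.1 : Matrix (Fin 2) (Fin 2) F) * A * (g.2 : Matrix (Fin 2) (Fin 2) F)

/-- Unfolding `act`. [cite: AlekseevNazarov2019, Lemma 1] -/
theorem act_def (g : Γ2 F) (A : Matrix (Fin 2) (Fin 2) F) :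
    act g A = (g.1 : Matrix (Fin 2) (Fin 2) F) * A * (g.2 : Matrix (Fin 2) (Fin 2) F) := rfl

/-- Composition of the action. [cite: AlekseevNazarov2019, Lemma 1] -/
theorem act_act (g h : Γ2 F) (A : Matrix (Fin 2) (Fin 2) F) :
    act g (act h A) = act (g.1 * h.1, h.2 * g.2) A := by
  simp only [act, Units.val_mul]
  simp only [Matrix.mul_assoc]

/-- The action of `(1, 1)`. [cite: AlekseevNazarov2019, Lemma 1] -/
@[simp] theorem act_one (A : Matrix (Fin 2) (Fin 2) F) : act (1 : Γ2 F) A = A := by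
  simp [act]

/-- Undoing the action. [cite: AlekseevNazarov2019, Lemma 1] -/
theorem act_inv_act (h : Γ2 F) (A : Matrix (Fin 2) (Fin 2) F) : act (h.1⁻¹, h.2⁻¹) (act h A) = A := by
  rw [act_act]
  simp only [inv_mul_cancel, mul_inv_cancel]
  exact act_one A

/-- Undoing the action. [cite: AlekseevNazarov2019, Lemma 1] -/
theorem act_act_inv (h : Γ2 F) (A : Matrix (Fin 2) (Fin 2) F) : act h (act (h.1⁻¹, h.2⁻¹) A) = A := by
  rw [act_act]
  simp only [mul_inv_cancel, inv_mul_cancel]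
  exact act_one A

/-! ### The three orbits: `0`, rank one, invertible -/

/-- Rank one: non-zero and singular. [cite: AlekseevNazarov2019, Lemma 3] -/
def IsRk1 (A : Matrix (Fin 2) (Fin 2) F) : Prop := A ≠ 0 ∧ A.det = 0

/-- Invertible. [cite: AlekseevNazarov2019, Lemma 3] -/
def IsRk2 (A : Matrix (Fin 2) (Fin 2) F) : Prop := A.det ≠ 0

/-- The action preserves rank one. [cite: AlekseevNazarov2019, Lemma 3] -/
theorem isRk1_act (g : Γ2 F) {A : Matrix (Fin 2) (Fin 2) F} (hA : IsRk1 A) : IsRk1 (act g A) := by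
  refine ⟨fun h0 => hA.1 ?_, ?_⟩
  · rw [← act_inv_act g A, h0]
    simp [act]
  · rw [act_def, Matrix.det_mul, Matrix.det_mul, hA.2, mul_zero, zero_mul]

/-- The action preserves invertibility. [cite: AlekseevNazarov2019, Lemma 3] -/
theorem isRk2_act (g : Γ2 F) {A : Matrix (Fin 2) (Fin 2) F} (hA : IsRk2 A) : IsRk2 (act g A) := by
  unfold IsRk2
  rw [act_def, Matrix.det_mul, Matrix.det_mul]
  refine mul_ne_zero (mul_ne_zero ?_ hA) ?_
  · exact (Matrix.isUnits_det_units g.1).ne_zero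
  · exact (Matrix.isUnits_det_units g.2).ne_zero

/-- `E₁₁` has rank one. [cite: AlekseevNazarov2019, Lemma 3] -/
theorem isRk1_single : IsRk1 (Matrix.single (0 : Fin 2) (0 : Fin 2) (1 : F)) := by
  refine ⟨fun h => ?_, by simp [Matrix.det_fin_two]⟩
  have := congrFun (congrFun h 0) 0
  simp at this

/-- **Lemma 3** (rank one): every rank-one matrix is `P E₁₁ Q`. [cite: AlekseevNazarov2019, Lemma 3] -/
theorem exists_act_single_eq {A : Matrix (Fin 2) (Fin 2) F} (hA : IsRk1 A) :
    ∃ g : Γ2 F, act g (Matrix.single 0 0 1) = A := by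
  obtain ⟨hA0, hdet⟩ := hA
  rw [Matrix.det_fin_two] at hdet
  have hE : Matrix.single (0 : Fin 2) (0 : Fin 2) (1 : F) = !![1, 0; 0, 0] := by
    ext i j
    fin_cases i <;> fin_cases j <;> simp
  rw [hE]
  -- `P`, `Q` with `P E₁₁ Q = A`, by cases on the position of a non-zero entry
  by_cases h00 : A 0 0 ≠ 0
  · refine ⟨(Matrix.GeneralLinearGroup.mkOfDetNeZero !![A 0 0, 0; A 1 0, 1]
      (by simp [Matrix.det_fin_two, h00]), Matrix.GeneralLinearGroup.mkOfDetNeZero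
      !![1, A 0 1 / A 0 0; 0, 1] (by simp [Matrix.det_fin_two])), ?_⟩
    have e1 : A 0 0 * (A 0 1 / A 0 0) = A 0 1 := by field_simp
    have e2 : A 1 0 * (A 0 1 / A 0 0) = A 1 1 := by
      field_simp
      linear_combination (-1 : F) * hdet
    simp only [act_def, Matrix.GeneralLinearGroup.val_mkOfDetNeZero, Matrix.mul_fin_two]
    ext i j
    fin_cases i <;> fin_cases j <;> simp [e1, e2]
  · rw [not_not] at h00
    by_cases h01 : A 0 1 ≠ 0
    · have h10 : A 1 0 = 0 := by
        have : A 0 1 * A 1 0 = 0 := by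
          rw [h00, zero_mul, zero_sub, neg_eq_zero] at hdet
          exact hdet
        exact (mul_eq_zero.1 this).resolve_left h01
      refine ⟨(Matrix.GeneralLinearGroup.mkOfDetNeZero !![A 0 1, 0; A 1 1, 1]
        (by simp [Matrix.det_fin_two, h01]), Matrix.GeneralLinearGroup.mkOfDetNeZero
        !![0, 1; 1, 0] (by simp [Matrix.det_fin_two])), ?_⟩
      simp only [act_def, Matrix.GeneralLinearGroup.val_mkOfDetNeZero, Matrix.mul_fin_two]
      ext i j
      fin_cases i <;> fin_cases j <;> simp [h00, h10]
    · rw [not_not] at h01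
      -- the first row vanishes; the second does not
      by_cases h10 : A 1 0 ≠ 0
      · refine ⟨(Matrix.GeneralLinearGroup.mkOfDetNeZero !![0, 1; 1, 0]
          (by simp [Matrix.det_fin_two]), Matrix.GeneralLinearGroup.mkOfDetNeZero
          !![A 1 0, A 1 1; 0, 1] (by simp [Matrix.det_fin_two, h10])), ?_⟩
        simp only [act_def, Matrix.GeneralLinearGroup.val_mkOfDetNeZero, Matrix.mul_fin_two]
        ext i j
        fin_cases i <;> fin_cases j <;> simp [h00, h01]
      · rw [not_not] at h10
        have h11 : A 1 1 ≠ 0 := by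
          intro h11
          apply hA0
          ext i j
          fin_cases i <;> fin_cases j <;> simp [h00, h01, h10, h11]
        refine ⟨(Matrix.GeneralLinearGroup.mkOfDetNeZero !![0, 1; 1, 0]
          (by simp [Matrix.det_fin_two]), Matrix.GeneralLinearGroup.mkOfDetNeZero
          !![0, A 1 1; 1, 0] (by simp [Matrix.det_fin_two, h11])), ?_⟩
        simp only [act_def, Matrix.GeneralLinearGroup.val_mkOfDetNeZero, Matrix.mul_fin_two]
        ext i j
        fin_cases i <;> fin_cases j <;> simp [h00, h01, h10]

/-- **Lemma 3** (invertible): every invertible matrix is `P · 1 · Q`. [cite: AlekseevNazarov2019, Lemma 3] -/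
theorem exists_act_one_eq {A : Matrix (Fin 2) (Fin 2) F} (hA : IsRk2 A) :
    ∃ g : Γ2 F, act g 1 = A :=
  ⟨(Matrix.GeneralLinearGroup.mkOfDetNeZero A hA, 1), by simp [act]⟩


end Action

section Counting

variable [Fintype F] [DecidableEq F]

/-- Rank one is decidable. [cite: AlekseevNazarov2019, Lemma 3] -/
instance : DecidablePred (IsRk1 (F := F)) := fun _ => inferInstanceAs (Decidable (_ ∧ _))

/-- Invertibility is decidable. [cite: AlekseevNazarov2019, Lemma 3] -/
instance : DecidablePred (IsRk2 (F := F)) := fun _ => inferInstanceAs (Decidable (_ ≠ _))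

/-- `N(A, C) = #{(P, Q) : P A Q = C}`. [cite: AlekseevNazarov2019, Lemma 1 (`N(A, L)`)] -/
noncomputable def cnt (A C : Matrix (Fin 2) (Fin 2) F) : ℕ :=
  (Finset.univ.filter fun g : Γ2 F => act g A = C).card

/-- `N(P₀ A Q₀, C) = N(A, C)`. [cite: AlekseevNazarov2019, Lemma 2 (proof)] -/
theorem cnt_act_left (h : Γ2 F) (A C : Matrix (Fin 2) (Fin 2) F) : cnt (act h A) C = cnt A C := by
  unfold cnt
  refine Finset.card_equiv ((Equiv.mulRight h.1).prodCongr (Equiv.mulLeft h.2)) fun g => ?_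
  simp only [Finset.mem_filter, Finset.mem_univ, true_and, Equiv.prodCongr_apply,
    Equiv.coe_mulRight, Equiv.coe_mulLeft, Prod.map, act_act]

/-- `N(A, P₀ C Q₀) = N(A, C)`. [cite: AlekseevNazarov2019, Lemma 2 (proof)] -/
theorem cnt_act_right (h : Γ2 F) (A C : Matrix (Fin 2) (Fin 2) F) : cnt A (act h C) = cnt A C := by
  unfold cnt
  refine Finset.card_equiv ((Equiv.mulLeft h.1⁻¹).prodCongr (Equiv.mulRight h.2⁻¹)) fun g => ?_
  simp only [Finset.mem_filter, Finset.mem_univ, true_and, Equiv.prodCongr_apply,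
    Equiv.coe_mulRight, Equiv.coe_mulLeft, Prod.map]
  have e : act (h.1⁻¹ * g.1, g.2 * h.2⁻¹) A = act (h.1⁻¹, h.2⁻¹) (act g A) := by rw [act_act]
  rw [e]
  constructor
  · intro hg
    rw [hg, act_inv_act]
  · intro hg
    rw [← act_act_inv h (act g A), hg]

/-- `∑_C N(A, C) = |G|²`. [cite: AlekseevNazarov2019, Lemma 1 (proof)] -/
theorem sum_cnt (A : Matrix (Fin 2) (Fin 2) F) : ∑ C, cnt A C = Fintype.card (Γ2 F) := by
  unfold cnt
  rw [← Finset.card_univ, Finset.card_eq_sum_card_fiberwise (f := fun g : Γ2 F => act g A)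
    (t := Finset.univ) (fun g _ => Finset.mem_coe.2 (Finset.mem_univ _))]

/-- **Lemma 2**: `N(A, C)` depends only on the orbits of `A` and `C`.
[cite: AlekseevNazarov2019, Lemma 2] -/
theorem cnt_eq_of_orbit {p : Matrix (Fin 2) (Fin 2) F → Prop} {B : Matrix (Fin 2) (Fin 2) F}
    (htrans : ∀ A, p A → ∃ g : Γ2 F, act g B = A) {A C : Matrix (Fin 2) (Fin 2) F} (hA : p A)
    (hC : p C) : cnt A C = cnt B B := by
  obtain ⟨g, rfl⟩ := htrans A hA
  obtain ⟨h, rfl⟩ := htrans C hC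
  rw [cnt_act_left, cnt_act_right]

/-- **Lemma 1**: `R_r · N_r = |G|²` for an orbit with `R_r` elements.
[cite: AlekseevNazarov2019, Lemma 1] -/
theorem card_mul_cnt {p : Matrix (Fin 2) (Fin 2) F → Prop} [DecidablePred p]
    {B : Matrix (Fin 2) (Fin 2) F} (hB : p B) (hpB : ∀ g : Γ2 F, p (act g B))
    (htrans : ∀ A, p A → ∃ g : Γ2 F, act g B = A) :
    (Finset.univ.filter p).card * cnt B B = Fintype.card (Γ2 F) := by
  rw [← sum_cnt B, ← Finset.sum_filter_add_sum_filter_not Finset.univ p]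
  have h0 : ∑ C ∈ Finset.univ.filter (fun C => ¬p C), cnt B C = 0 := by
    refine Finset.sum_eq_zero fun C hC => ?_
    have hC' := (Finset.mem_filter.1 hC).2
    unfold cnt
    rw [Finset.card_eq_zero, Finset.filter_eq_empty_iff]
    intro g _ hg
    exact hC' (hg ▸ hpB g)
  rw [h0, add_zero, Finset.sum_congr rfl (fun C hC =>
    (cnt_eq_of_orbit htrans hB (Finset.mem_filter.1 hC).2 : cnt B C = cnt B B)),
    Finset.sum_const, smul_eq_mul]

/-! ### The sizes of the group and of the orbits -/

/-- `|GL₂(F)| = (K² − 1)(K² − K)`. [cite: AlekseevNazarov2019, §3 (`|G| = (K²−1)(K²−K)`)] -/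
theorem card_GL2 : Fintype.card (GL (Fin 2) F) =
    (Fintype.card F ^ 2 - 1) * (Fintype.card F ^ 2 - Fintype.card F) := by
  rw [← Nat.card_eq_fintype_card, Matrix.card_GL_field 2]
  simp [Fin.prod_univ_two]

/-- `R₂ = |G|`: the invertible matrices. [cite: AlekseevNazarov2019, Lemma 4 (`R₂`)] -/
theorem card_isRk2 : (Finset.univ.filter (IsRk2 (F := F))).card = Fintype.card (GL (Fin 2) F) := by
  rw [← Fintype.card_subtype]
  refine Fintype.card_congr
    { toFun := fun A => Matrix.GeneralLinearGroup.mkOfDetNeZero A.1 A.2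
      invFun := fun g => ⟨(g : Matrix (Fin 2) (Fin 2) F), (Matrix.isUnits_det_units g).ne_zero⟩
      left_inv := fun A => rfl
      right_inv := fun g => Units.ext rfl }

omit [Field F] [DecidableEq F] in
/-- `|F^{2×2}| = K⁴`. [folklore] -/
private theorem card_M2 : Fintype.card (Matrix (Fin 2) (Fin 2) F) = Fintype.card F ^ 4 := by
  rw [show Fintype.card (Matrix (Fin 2) (Fin 2) F) = Fintype.card (Fin 2 → Fin 2 → F) from rfl,
    Fintype.card_fun, Fintype.card_fun, Fintype.card_fin]
  ring

/-- `1 + R₁ + R₂ = K⁴` (the three orbits exhaust `F^{2×2}`). [cite: AlekseevNazarov2019, Lemma 4 (`R₁ = K⁴ − 1 − |G|`)] -/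
theorem card_orbits : 1 + (Finset.univ.filter (IsRk1 (F := F))).card +
    (Finset.univ.filter (IsRk2 (F := F))).card = Fintype.card F ^ 4 := by
  rw [← card_M2, ← Finset.card_univ, ← Finset.card_filter_add_card_filter_not
    (s := (Finset.univ : Finset (Matrix (Fin 2) (Fin 2) F))) (fun A => A.det = 0)]
  have h2 : (Finset.univ.filter fun A : Matrix (Fin 2) (Fin 2) F => ¬A.det = 0) =
      Finset.univ.filter (IsRk2 (F := F)) := rfl
  rw [h2, ← Finset.card_filter_add_card_filter_not
    (s := Finset.univ.filter fun A : Matrix (Fin 2) (Fin 2) F => A.det = 0) (fun A => A = 0)]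
  have h0 : ((Finset.univ.filter fun A : Matrix (Fin 2) (Fin 2) F => A.det = 0).filter
      fun A => A = 0) = {0} := by
    ext A
    simp only [Finset.mem_filter, Finset.mem_univ, true_and, Finset.mem_singleton]
    constructor
    · exact fun h => h.2
    · rintro rfl; simp
  have h1 : ((Finset.univ.filter fun A : Matrix (Fin 2) (Fin 2) F => A.det = 0).filter
      fun A => ¬A = 0) = Finset.univ.filter (IsRk1 (F := F)) := by
    ext A
    simp only [Finset.mem_filter, Finset.mem_univ, true_and, IsRk1]
    tauto
  rw [h0, h1, Finset.card_singleton]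

/-! ### The subspaces `L₁`, `L₂` and their elements by rank -/

/-- `C ∈ L₁ = ⟨E₁₁, E₁₂ − E₂₁⟩`. [cite: AlekseevNazarov2019, §3 (subspaces of type 1)] -/
def IsT1 (C : Matrix (Fin 2) (Fin 2) F) : Prop := C 0 1 + C 1 0 = 0 ∧ C 1 1 = 0

/-- `C ∈ L₂ = ⟨E₁₁, E₁₂⟩`. [cite: AlekseevNazarov2019, §3 (subspaces of type 2)] -/
def IsT2 (C : Matrix (Fin 2) (Fin 2) F) : Prop := C 1 0 = 0 ∧ C 1 1 = 0

/-- Membership in `L₁` is decidable. [cite: AlekseevNazarov2019, §3] -/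
instance : DecidablePred (IsT1 (F := F)) := fun _ => inferInstanceAs (Decidable (_ ∧ _))

/-- Membership in `L₂` is decidable. [cite: AlekseevNazarov2019, §3] -/
instance : DecidablePred (IsT2 (F := F)) := fun _ => inferInstanceAs (Decidable (_ ∧ _))

/-- `L₁` has `K − 1` elements of rank one (`a E₁₁`, `a ≠ 0`). [cite: AlekseevNazarov2019, Theorem (proof, the count for `L₁`)] -/
theorem card_T1_rk1 : (Finset.univ.filter fun C : Matrix (Fin 2) (Fin 2) F => IsT1 C ∧ IsRk1 C).card =
    Fintype.card F - 1 := by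
  have h : (Finset.univ.filter fun C : Matrix (Fin 2) (Fin 2) F => IsT1 C ∧ IsRk1 C) =
      (Finset.univ.filter fun a : F => a ≠ 0).image fun a => !![a, 0; 0, 0] := by
    ext C
    simp only [Finset.mem_filter, Finset.mem_univ, true_and, Finset.mem_image, IsT1, IsRk1,
      Matrix.det_fin_two]
    constructor
    · rintro ⟨⟨h1, h2⟩, h3, h4⟩
      have h01 : C 0 1 = 0 := by
        have h10 : C 1 0 = -C 0 1 := by linear_combination h1
        rw [h2, h10, mul_zero, zero_sub, mul_neg, neg_neg] at h4
        exact pow_eq_zero_iff (n := 2) (by norm_num) |>.1 (by rw [pow_two]; exact h4)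
      have h10 : C 1 0 = 0 := by linear_combination h1 - h01
      refine ⟨C 0 0, fun h00 => h3 ?_, ?_⟩
      · ext i j
        fin_cases i <;> fin_cases j <;> simp [h00, h01, h10, h2]
      · ext i j
        fin_cases i <;> fin_cases j <;> simp [h01, h10, h2]
    · rintro ⟨a, ha, rfl⟩
      refine ⟨⟨by simp, by simp⟩, fun h => ha ?_, by simp⟩
      have := congrFun (congrFun h 0) 0
      simpa using this
  rw [h, Finset.card_image_of_injective _ (fun a b hab => by
    have := congrFun (congrFun hab 0) 0; simpa using this)]
  rw [Finset.filter_ne' Finset.univ (0 : F), Finset.card_erase_of_mem (Finset.mem_univ _),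
    Finset.card_univ]

/-- `L₁` has `K² − K` invertible elements (`a E₁₁ + b (E₁₂ − E₂₁)`, `b ≠ 0`). [cite: AlekseevNazarov2019, Theorem (proof, the count for `L₁`)] -/
theorem card_T1_rk2 : (Finset.univ.filter fun C : Matrix (Fin 2) (Fin 2) F => IsT1 C ∧ IsRk2 C).card =
    Fintype.card F ^ 2 - Fintype.card F := by
  have h : (Finset.univ.filter fun C : Matrix (Fin 2) (Fin 2) F => IsT1 C ∧ IsRk2 C) =
      ((Finset.univ : Finset F) ×ˢ (Finset.univ.filter fun b : F => b ≠ 0)).image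
        fun ab => !![ab.1, ab.2; -ab.2, 0] := by
    ext C
    simp only [Finset.mem_filter, Finset.mem_univ, true_and, Finset.mem_image, IsT1, IsRk2,
      Matrix.det_fin_two, Finset.mem_product, Prod.exists]
    constructor
    · rintro ⟨⟨h1, h2⟩, h4⟩
      have h10 : C 1 0 = -C 0 1 := by linear_combination h1
      refine ⟨C 0 0, C 0 1, fun h01 => h4 ?_, ?_⟩
      · rw [h2, h10, h01]; ring
      · ext i j
        fin_cases i <;> fin_cases j <;> simp [h10, h2]
    · rintro ⟨a, b, hb, rfl⟩
      refine ⟨⟨by simp, by simp⟩, ?_⟩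
      simp only [Matrix.of_apply, Matrix.cons_val', Matrix.cons_val_zero, Matrix.cons_val_one,
        Matrix.empty_val', Matrix.cons_val_fin_one]
      rw [mul_zero, zero_sub, mul_neg, neg_neg]
      exact mul_ne_zero hb hb
  rw [h, Finset.card_image_of_injective _ (fun ab ab' hab => by
    have h1 := congrFun (congrFun hab 0) 0
    have h2 := congrFun (congrFun hab 0) 1
    simp at h1 h2
    exact Prod.ext h1 h2)]
  rw [Finset.card_product, Finset.filter_ne' Finset.univ (0 : F),
    Finset.card_erase_of_mem (Finset.mem_univ _), Finset.card_univ, Nat.mul_sub_one, pow_two]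

/-- `L₂` has `K² − 1` elements of rank one (all its non-zero elements). [cite: AlekseevNazarov2019, Theorem (proof, the count for `L₂`)] -/
theorem card_T2_rk1 : (Finset.univ.filter fun C : Matrix (Fin 2) (Fin 2) F => IsT2 C ∧ IsRk1 C).card =
    Fintype.card F ^ 2 - 1 := by
  have h : (Finset.univ.filter fun C : Matrix (Fin 2) (Fin 2) F => IsT2 C ∧ IsRk1 C) =
      (Finset.univ.filter fun ab : F × F => ab ≠ 0).image fun ab => !![ab.1, ab.2; 0, 0] := by
    ext C
    simp only [Finset.mem_filter, Finset.mem_univ, true_and, Finset.mem_image, IsT2, IsRk1,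
      Matrix.det_fin_two, Prod.exists]
    constructor
    · rintro ⟨⟨h1, h2⟩, h3, -⟩
      refine ⟨C 0 0, C 0 1, fun h0 => h3 ?_, ?_⟩
      · have ha : C 0 0 = 0 := congrArg Prod.fst h0
        have hb : C 0 1 = 0 := congrArg Prod.snd h0
        ext i j
        fin_cases i <;> fin_cases j <;> simp [ha, hb, h1, h2]
      · ext i j
        fin_cases i <;> fin_cases j <;> simp [h1, h2]
    · rintro ⟨a, b, hab, rfl⟩
      refine ⟨⟨by simp, by simp⟩, fun h => hab ?_, by simp⟩
      have h1 := congrFun (congrFun h 0) 0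
      have h2 := congrFun (congrFun h 0) 1
      simp at h1 h2
      exact Prod.ext h1 h2
  rw [h, Finset.card_image_of_injective _ (fun ab ab' hab => by
    have h1 := congrFun (congrFun hab 0) 0
    have h2 := congrFun (congrFun hab 0) 1
    simp at h1 h2
    exact Prod.ext h1 h2)]
  rw [Finset.filter_ne' Finset.univ (0 : F × F), Finset.card_erase_of_mem (Finset.mem_univ _),
    Finset.card_univ, Fintype.card_prod, pow_two]

/-! ### Double counting -/

/-- `∑_{(P,Q)} #{t : P A_t Q ∈ L} = ∑_t #{(P,Q) : P A_t Q ∈ L}`. [cite: AlekseevNazarov2019, Theorem (proof, "подсчитаем двумя способами")] -/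
private theorem sum_card_comm (As : ι → Matrix (Fin 2) (Fin 2) F) (q : Matrix (Fin 2) (Fin 2) F → Prop)
    [DecidablePred q] :
    ∑ g : Γ2 F, (Finset.univ.filter fun t : ι => q (act g (As t))).card =
      ∑ t : ι, (Finset.univ.filter fun g : Γ2 F => q (act g (As t))).card := by
  simp only [Finset.card_filter]
  exact Finset.sum_comm

/-- Pigeonhole: some pair `(P, Q)` does at least average. [cite: AlekseevNazarov2019, Theorem (proof)] -/
private theorem exists_good (As : ι → Matrix (Fin 2) (Fin 2) F) (q : Matrix (Fin 2) (Fin 2) F → Prop)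
    [DecidablePred q] :
    ∃ g : Γ2 F, ∑ t : ι, (Finset.univ.filter fun g' : Γ2 F => q (act g' (As t))).card ≤
      (Finset.univ.filter fun t : ι => q (act g (As t))).card * Fintype.card (Γ2 F) := by
  obtain ⟨g, -, hg⟩ := Finset.exists_le_of_sum_le (s := (Finset.univ : Finset (Γ2 F)))
    (f := fun _ => ∑ t : ι, (Finset.univ.filter fun g' : Γ2 F => q (act g' (As t))).card)
    (g := fun g => (Finset.univ.filter fun t : ι => q (act g (As t))).card * Fintype.card (Γ2 F))
    Finset.univ_nonempty (le_of_eq (by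
      rw [Finset.sum_const, smul_eq_mul, ← Finset.sum_mul, sum_card_comm, Finset.card_univ,
        mul_comm]))
  exact ⟨g, hg⟩

/-- `#{(P,Q) : P A Q ∈ L} = ∑_{C ∈ L} N(A, C)`. [cite: AlekseevNazarov2019, Lemma 1 (`N(A, L)`)] -/
private theorem card_eq_sum_cnt (q : Matrix (Fin 2) (Fin 2) F → Prop) [DecidablePred q]
    (A : Matrix (Fin 2) (Fin 2) F) :
    (Finset.univ.filter fun g : Γ2 F => q (act g A)).card = ∑ C ∈ Finset.univ.filter q, cnt A C := by
  unfold cnt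
  rw [Finset.card_eq_sum_card_fiberwise (f := fun g : Γ2 F => act g A) (t := Finset.univ.filter q)
    (fun g hg => by simpa using hg)]
  refine Finset.sum_congr rfl fun C hC => ?_
  congr 1
  ext g
  simp only [Finset.mem_filter, Finset.mem_univ, true_and]
  exact ⟨fun h => h.2, fun h => ⟨by rw [h]; exact (Finset.mem_filter.1 hC).2, h⟩⟩

/-- For `A` in an orbit with base point `B`: `#{(P,Q) : P A Q ∈ L} ≥ #(L ∩ orbit) · N(B, B)`.
[cite: AlekseevNazarov2019, Theorem (proof, the sums `∑ N(A_i, L)`)] -/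
private theorem card_mul_cnt_le (q p : Matrix (Fin 2) (Fin 2) F → Prop) [DecidablePred q] [DecidablePred p]
    {B : Matrix (Fin 2) (Fin 2) F} (htrans : ∀ A, p A → ∃ g : Γ2 F, act g B = A)
    {A : Matrix (Fin 2) (Fin 2) F} (hA : p A) :
    (Finset.univ.filter fun C => q C ∧ p C).card * cnt B B ≤
      (Finset.univ.filter fun g : Γ2 F => q (act g A)).card := by
  rw [card_eq_sum_cnt]
  calc (Finset.univ.filter fun C => q C ∧ p C).card * cnt B B
      = ∑ C ∈ Finset.univ.filter (fun C => q C ∧ p C), cnt A C := by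
        rw [Finset.sum_congr rfl (fun C hC =>
          cnt_eq_of_orbit htrans hA (Finset.mem_filter.1 hC).2.2), Finset.sum_const, smul_eq_mul]
    _ ≤ ∑ C ∈ Finset.univ.filter q, cnt A C :=
        Finset.sum_le_sum_of_subset fun C hC => by
          simp only [Finset.mem_filter, Finset.mem_univ, true_and] at hC ⊢
          exact hC.1

/-- The printed arithmetic: from the two averaged counts to `(K² + 2) d ≥ 3 (K² + 3) m` (`K = n + 2`).
[cite: AlekseevNazarov2019, Theorem (proof, last paragraph)] -/
private theorem arith (n d m d0 d1 d2 γ N1 N2 r1 : ℕ) (hd : d0 + d1 + d2 = d)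
    (hγ : γ = (n + 1) ^ 2 * (n + 2) * (n + 3)) (hr1 : 1 + r1 + γ = (n + 2) ^ 4)
    (hN1 : r1 * N1 = γ ^ 2) (hN2 : γ * N2 = γ ^ 2)
    (h1 : d0 * γ ^ 2 + d1 * ((n + 1) * N1) + d2 * (((n + 2) * (n + 1)) * N2) + 3 * m * γ ^ 2 ≤
      d * γ ^ 2)
    (h2 : d0 * γ ^ 2 + d1 * (((n + 1) * (n + 3)) * N1) + 6 * m * γ ^ 2 ≤ 2 * d * γ ^ 2) :
    3 * ((n + 2) ^ 2 + 3) * m ≤ ((n + 2) ^ 2 + 2) * d := by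
  have hr1' : r1 = (n + 1) * (n + 3) ^ 2 := by
    subst hγ
    ring_nf at hr1 ⊢
    omega
  subst hr1'
  have hγpos : 0 < γ := by rw [hγ]; positivity
  have hN2' : N2 = γ := Nat.eq_of_mul_eq_mul_left hγpos (by rw [hN2, pow_two])
  have hN1' : N1 = (n + 1) ^ 3 * (n + 2) ^ 2 := by
    apply Nat.eq_of_mul_eq_mul_left (show 0 < (n + 1) * (n + 3) ^ 2 by positivity)
    rw [hN1, hγ]
    ring
  subst hN2' hN1' hγ
  have h1' : (n + 1) ^ 3 * (n + 2) ^ 2 *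
      (d0 * ((n + 1) * (n + 3) ^ 2) + d1 * (n + 1) + d2 * (n + 3) + 3 * m * ((n + 1) * (n + 3) ^ 2)) ≤
      (n + 1) ^ 3 * (n + 2) ^ 2 * (d * ((n + 1) * (n + 3) ^ 2)) := by
    convert h1 using 1 <;> ring
  have h1'' := Nat.le_of_mul_le_mul_left h1' (by positivity)
  have h2' : (n + 1) ^ 4 * (n + 2) ^ 2 * (n + 3) * (d0 * (n + 3) + d1 + 6 * m * (n + 3)) ≤
      (n + 1) ^ 4 * (n + 2) ^ 2 * (n + 3) * (2 * d * (n + 3)) := by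
    convert h2 using 1 <;> ring
  have h2'' := Nat.le_of_mul_le_mul_left h2' (by positivity)
  have hslack : (n + 3) * d0 ≤ ((n + 1) * (n + 3) ^ 2 + 2 * (n + 3)) * d0 :=
    Nat.mul_le_mul_right _ (by nlinarith)
  have hd' : (n + 3) * (d0 + d1 + d2) = (n + 3) * d := by rw [hd]
  have key : (n + 3) * (3 * ((n + 2) ^ 2 + 3) * m) ≤ (n + 3) * (((n + 2) ^ 2 + 2) * d) := by
    nlinarith [h1'', h2'', hd', hslack]
  exact Nat.le_of_mul_le_mul_left key (by omega)

/-! ### The Theorem for a computation -/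

/-- **Theorem (for a computation).** A bilinear computation of `⟨2,2,m⟩` over a field with `K` elements
has `d` terms with `(K² + 2) d ≥ 3 (K² + 3) m`. [cite: AlekseevNazarov2019, Theorem] -/
theorem card_ge (β : BilinComp (mulBilin F 2 2 m) ι) :
    3 * (Fintype.card F ^ 2 + 3) * m ≤ (Fintype.card F ^ 2 + 2) * Fintype.card ι := by
  classical
  obtain ⟨n, hn⟩ : ∃ n, Fintype.card F = n + 2 :=
    ⟨Fintype.card F - 2, by have := Fintype.one_lt_card (α := F); omega⟩
  -- the constants of the counting
  let As := A β
  let E1 : Matrix (Fin 2) (Fin 2) F := Matrix.single 0 0 1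
  let γ := Fintype.card (GL (Fin 2) F)
  have hΓ : Fintype.card (Γ2 F) = γ ^ 2 := by rw [Fintype.card_prod, pow_two]
  have e1 : (n + 2) ^ 2 - 1 = (n + 1) * (n + 3) := by
    rw [show (n + 2) ^ 2 = (n + 1) * (n + 3) + 1 by ring, Nat.add_sub_cancel]
  have e2 : (n + 2) ^ 2 - (n + 2) = (n + 2) * (n + 1) := by
    rw [show (n + 2) ^ 2 = (n + 2) * (n + 1) + (n + 2) by ring, Nat.add_sub_cancel]
  have hγ : γ = (n + 1) ^ 2 * (n + 2) * (n + 3) := by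
    show Fintype.card (GL (Fin 2) F) = _
    rw [card_GL2, hn, e1, show (n + 2) ^ 2 - (n + 2) = (n + 2) * (n + 1) from e2]
    ring
  let r1 := (Finset.univ.filter (IsRk1 (F := F))).card
  have hr1 : 1 + r1 + γ = (n + 2) ^ 4 := by rw [← hn, ← card_orbits (F := F), card_isRk2]
  have hN1 : r1 * cnt E1 E1 = γ ^ 2 := by
    rw [← hΓ]
    exact card_mul_cnt isRk1_single (fun g => isRk1_act g isRk1_single)
      (fun A hA => exists_act_single_eq hA)
  have hone : IsRk2 (1 : Matrix (Fin 2) (Fin 2) F) := by simp [IsRk2]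
  have hN2 : γ * cnt (1 : Matrix (Fin 2) (Fin 2) F) 1 = γ ^ 2 := by
    rw [← hΓ]
    show Fintype.card (GL (Fin 2) F) * _ = _
    rw [← card_isRk2]
    exact card_mul_cnt hone (fun g => isRk2_act g hone) (fun A hA => exists_act_one_eq hA)
  -- the three classes of indices
  let T0 : Finset ι := Finset.univ.filter fun t => As t = 0
  let T1 : Finset ι := Finset.univ.filter fun t => IsRk1 (As t)
  let T2 : Finset ι := Finset.univ.filter fun t => IsRk2 (As t)
  have hsplit : ∀ s : ι → ℕ, ∑ t, s t = ∑ t ∈ T0, s t + ∑ t ∈ T1, s t + ∑ t ∈ T2, s t := by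
    intro s
    rw [← Finset.sum_filter_add_sum_filter_not Finset.univ (fun t => As t = 0),
      ← Finset.sum_filter_add_sum_filter_not (Finset.univ.filter fun t => ¬As t = 0)
        (fun t => (As t).det = 0), Finset.filter_filter, Finset.filter_filter, add_assoc]
    have hT1 : (Finset.univ.filter fun t => ¬As t = 0 ∧ (As t).det = 0) = T1 := by
      ext t; simp [T1, IsRk1]
    have hT2 : (Finset.univ.filter fun t => ¬As t = 0 ∧ ¬(As t).det = 0) = T2 := by
      ext t
      simp only [Finset.mem_filter, Finset.mem_univ, true_and, T2, IsRk2]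
      constructor
      · exact fun h => h.2
      · intro h
        refine ⟨fun h0 => h ?_, h⟩
        rw [h0, Matrix.det_zero]
    rw [hT1, hT2]
  have hd : T0.card + T1.card + T2.card = Fintype.card ι := by
    have := hsplit fun _ => 1
    simpa using this.symm
  -- type 1
  obtain ⟨g1, hg1⟩ := exists_good As IsT1
  let β1 := twist β (g1.1 : Matrix (Fin 2) (Fin 2) F) (g1.2 : Matrix (Fin 2) (Fin 2) F)
    (Matrix.isUnits_det_units g1.1) (Matrix.isUnits_det_units g1.2)
  have hZ1 : Z1 β1 = Finset.univ.filter fun t => IsT1 (act g1 (As t)) := by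
    ext t
    simp only [mem_Z1, Finset.mem_filter, Finset.mem_univ, true_and, IsT1, β1, A_twist, act_def]
    exact Iff.rfl
  have hL6 := three_mul_add_card_Z1_le β1
  rw [hZ1] at hL6
  have hS1 : T0.card * γ ^ 2 + T1.card * ((n + 1) * cnt E1 E1) +
      T2.card * (((n + 2) * (n + 1)) * cnt (1 : Matrix (Fin 2) (Fin 2) F) 1) ≤
      ∑ t, (Finset.univ.filter fun g : Γ2 F => IsT1 (act g (As t))).card := by
    rw [hsplit]
    refine add_le_add (add_le_add ?_ ?_) ?_
    · rw [← smul_eq_mul]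
      refine Finset.card_nsmul_le_sum _ _ _ fun t ht => ?_
      have h0 : As t = 0 := (Finset.mem_filter.1 ht).2
      rw [h0, Finset.filter_true_of_mem (fun g _ => by simp [act, IsT1]), Finset.card_univ, hΓ]
    · rw [← smul_eq_mul]
      refine Finset.card_nsmul_le_sum _ _ _ fun t ht => ?_
      have h := card_mul_cnt_le IsT1 IsRk1 (fun A hA => exists_act_single_eq hA)
        (Finset.mem_filter.1 ht).2
      rwa [card_T1_rk1, hn, show n + 2 - 1 = n + 1 by rfl] at h
    · rw [← smul_eq_mul]
      refine Finset.card_nsmul_le_sum _ _ _ fun t ht => ?_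
      have h := card_mul_cnt_le IsT1 IsRk2 (fun A hA => exists_act_one_eq hA)
        (Finset.mem_filter.1 ht).2
      rwa [card_T1_rk2, hn, e2] at h
  have h1 : T0.card * γ ^ 2 + T1.card * ((n + 1) * cnt E1 E1) +
      T2.card * (((n + 2) * (n + 1)) * cnt (1 : Matrix (Fin 2) (Fin 2) F) 1) + 3 * m * γ ^ 2 ≤
      Fintype.card ι * γ ^ 2 := by
    have ha := hS1.trans hg1
    rw [hΓ] at ha
    have hb := Nat.mul_le_mul_right (γ ^ 2) hL6
    nlinarith [ha, hb]
  -- type 2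
  obtain ⟨g2, hg2⟩ := exists_good As IsT2
  let β2 := twist β (g2.1 : Matrix (Fin 2) (Fin 2) F) (g2.2 : Matrix (Fin 2) (Fin 2) F)
    (Matrix.isUnits_det_units g2.1) (Matrix.isUnits_det_units g2.2)
  have hZ2 : Z2 β2 = Finset.univ.filter fun t => IsT2 (act g2 (As t)) := by
    ext t
    simp only [mem_Z2, Finset.mem_filter, Finset.mem_univ, true_and, IsT2, β2, A_twist, act_def]
    exact Iff.rfl
  have hL7 := six_mul_add_card_Z2_le β2
  rw [hZ2] at hL7
  have hS2 : T0.card * γ ^ 2 + T1.card * (((n + 1) * (n + 3)) * cnt E1 E1) ≤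
      ∑ t, (Finset.univ.filter fun g : Γ2 F => IsT2 (act g (As t))).card := by
    rw [hsplit]
    refine le_trans (add_le_add ?_ ?_) (Nat.le_add_right _ _)
    · rw [← smul_eq_mul]
      refine Finset.card_nsmul_le_sum _ _ _ fun t ht => ?_
      have h0 : As t = 0 := (Finset.mem_filter.1 ht).2
      rw [h0, Finset.filter_true_of_mem (fun g _ => by simp [act, IsT2]), Finset.card_univ, hΓ]
    · rw [← smul_eq_mul]
      refine Finset.card_nsmul_le_sum _ _ _ fun t ht => ?_
      have h := card_mul_cnt_le IsT2 IsRk1 (fun A hA => exists_act_single_eq hA)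
        (Finset.mem_filter.1 ht).2
      rwa [card_T2_rk1, hn, e1] at h
  have h2 : T0.card * γ ^ 2 + T1.card * (((n + 1) * (n + 3)) * cnt E1 E1) + 6 * m * γ ^ 2 ≤
      2 * Fintype.card ι * γ ^ 2 := by
    have ha := hS2.trans hg2
    rw [hΓ] at ha
    have hb := Nat.mul_le_mul_right (γ ^ 2) hL7
    nlinarith [ha, hb]
  rw [hn]
  exact arith n (Fintype.card ι) m T0.card T1.card T2.card γ (cnt E1 E1) (cnt 1 1) r1 hd hγ hr1
    hN1 hN2 h1 h2

end Counting

end AlekseevNazarov2019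

/-! ## The Theorem and its corollaries -/

/-- **Alekseev–Nazarov 2019, Theorem** (integer form): over a finite field with `K` elements,
`(K² + 2) · R(⟨2,2,m⟩) ≥ 3 (K² + 3) · m` for every `m`. [cite: AlekseevNazarov2019, Theorem] -/
theorem alekseevNazarov2019_rank_matMulTensor_22m_ge (F : Type*) [Field F] [Fintype F] (m : ℕ) :
    3 * (Fintype.card F ^ 2 + 3) * m ≤ (Fintype.card F ^ 2 + 2) * tensorRank (matMulTensor F 2 2 m) := by
  classical
  obtain ⟨β⟩ := exists_bilinComp_of_tensorRank_le (k := F) (c := 2) (m := 2) (n := m) le_rfl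
  have h := AlekseevNazarov2019.card_ge β
  rwa [Fintype.card_fin] at h

/-- **Alekseev–Nazarov 2019, Theorem** (as printed): `R(⟨2,2,m⟩) ≥ (3 + 3/(K² + 2)) m` over a finite
field with `K` elements. [cite: AlekseevNazarov2019, Theorem] -/
theorem alekseevNazarov2019_rank_matMulTensor_22m_ge' (F : Type*) [Field F] [Fintype F] (m : ℕ) :
    (3 + 3 / ((Fintype.card F : ℚ) ^ 2 + 2)) * m ≤ (tensorRank (matMulTensor F 2 2 m) : ℚ) := by
  have h := alekseevNazarov2019_rank_matMulTensor_22m_ge F m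
  have hK : (0 : ℚ) < (Fintype.card F : ℚ) ^ 2 + 2 := by positivity
  have h' : 3 * ((Fintype.card F : ℚ) ^ 2 + 3) * m ≤
      ((Fintype.card F : ℚ) ^ 2 + 2) * (tensorRank (matMulTensor F 2 2 m) : ℚ) := by
    exact_mod_cast h
  rw [show (3 + 3 / ((Fintype.card F : ℚ) ^ 2 + 2)) =
      3 * ((Fintype.card F : ℚ) ^ 2 + 3) / ((Fintype.card F : ℚ) ^ 2 + 2) by field_simp; ring,
    div_mul_eq_mul_div, div_le_iff₀ hK]
  linarith

/-- **`R(⟨2,2,n⟩) = ⌈7n/2⌉` over a field with two elements** (Hopcroft–Kerr 1971; the lower bound is the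
case `K = 2` of Alekseev–Nazarov: `6 R ≥ 21 n`), for every `n`.
[cite: AlekseevNazarov2019, Theorem (K = 2); HopcroftKerr1971, Thm 3 (upper bound)] -/
theorem tensorRank_matMulTensor_22n_card_two (F : Type) [Field F] [Fintype F] (hF : Fintype.card F = 2)
    (n : ℕ) : tensorRank (matMulTensor F 2 2 n) = (7 * n + 1) / 2 := by
  have h := alekseevNazarov2019_rank_matMulTensor_22m_ge F n
  rw [hF] at h
  have hu := hopcroftKerr1971_tensorRank_matMulTensor_22n_le (K := F) n
  omega

/-- The rotated formats over a field with two elements: `R(⟨2,n,2⟩) = R(⟨n,2,2⟩) = ⌈7n/2⌉`.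
[cite: AlekseevNazarov2019, Theorem (K = 2); HopcroftKerr1971, Thm 3] -/
theorem tensorRank_matMulTensor_2n2_n22_card_two (F : Type) [Field F] [Fintype F]
    (hF : Fintype.card F = 2) (n : ℕ) :
    tensorRank (matMulTensor F 2 n 2) = (7 * n + 1) / 2 ∧
      tensorRank (matMulTensor F n 2 2) = (7 * n + 1) / 2 := by
  refine ⟨?_, ?_⟩
  · rw [tensorRank_matMulTensor_rotate, tensorRank_matMulTensor_rotate,
      ← tensorRank_matMulTensor_22n_card_two F hF n]
  · rw [tensorRank_matMulTensor_rotate, ← tensorRank_matMulTensor_22n_card_two F hF n]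

/-- Over a field with three elements: `11 · R(⟨2,2,m⟩) ≥ 36 m`, e.g. `R_𝔽₃(⟨2,2,5⟩) ≥ 17`
(the same integer as over every field). [cite: AlekseevNazarov2019, Theorem (K = 3)] -/
theorem alekseevNazarov2019_card_three (F : Type) [Field F] [Fintype F] (hF : Fintype.card F = 3)
    (m : ℕ) : 36 * m ≤ 11 * tensorRank (matMulTensor F 2 2 m) := by
  have h := alekseevNazarov2019_rank_matMulTensor_22m_ge F m
  rw [hF] at h
  omega


end Literature.Computability.AlgebraicComplexity
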